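import Mathlib
import HarnessLib

/-!
# KL programme — K3 ENGINE child (`KLRegimeEngineV17F2`, stmt-HubbardSuperconductivity-20437), stub (b) weighted lines, cure (c-D): the THIRD-ORDER THRESHOLD
# CONDITION `X₃` (deepest Laurent coefficients) of the (c-D) chain DISCHARGED at the harmless depth `m₀(j) = 2j + 5 + ⌈log₄U⁻²⌉` — one `U₀`-type smallness condition each

Cell `gate-hubbard-kl`, seat hubbard-kl-k3c3-p2 (g9); v2 token #19 (`klCDBase`, `…EngineWtBudgetF`); located risk «(b)-Wt@j≥1»; evidence #48 CD-LIMITS.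
`…EngineSliceSpaceMoment(ScaleWt)` asks, at the base depth `m₀`, for `3X₁ ≤ k₁G₃x`, `3X₂ ≤ k₁G₃x²`, `3X₃ ≤ k₁G₃x³`, `2Y₁ ≤ k₁G₂x`, `2Y₂ ≤ k₁G₂x²`
(`x = 4^{m₀}`; `…SectorSliceIncrRates`).  In the flow's currency — `k_r = κ_r/Λ_j^{r+1}` (slice constants), `G₀ = Gfr₀·|U|`, `G_i = Gfr_i·U²` (`i ≥ 1`),
multiplier scale data `α_k = a_k/Λ_j^k`, band constants `b` — every monomial of `X_i`, `Y_i` carries `|U|^p/Λ_j^q` with `p ≥ 1`, `q ≤ 5`, while at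
`m ≥ m₀(j)` one has `x ≥ 4^{2j+5}/U² = 1024e₀²/(U²Λ_j²)` (`Λ_j = e₀4^{−j}`), so `k₁G x^i ≥ 1024^i κ₁ g e₀^{2i}·|U|^{2−2i}·Λ_j^{−2−2i}` DOMINATES each monomial by a
power of `|U|` — uniformly in `j` (E1-WORD10 (W1)/(W3): the thresholds are `U₀`-conditions, not `n`- or `j`-conditions):

* **`cd_threshold_X3`** (this file; `X1/X2/Y1/Y2` and `cd_depth_lower` in `…EngineCDThresholdsLow`) — each threshold from ONE explicit condition `N·|U|·S ≤ 1024^i κ₁ g e₀^{2i}` (`S` a `|U|`-free polynomial in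
  `κ, Gfr, a, b, e₀`), for every `x` with `1024e₀² ≤ x·U²Λ²`, `0 < Λ ≤ e₀`, `0 < |U| ≤ 1`;
* **`cd_depth_lower`** — `klCDBase`-free form of the depth: `m ≥ 2j + 5 + ⌈log₄(U²)⁻¹⌉₊ ⇒ 1024·e₀² ≤ 4^m·(U²·(klScale e₀ j)²)`.

Pure real algebra; no definitions, no sorry.  Nothing asserts superconductivity.
-/

noncomputable section

namespace Summit.HubbardSuperconductivity.HubbardSuperconductivity.Theorems.EngineV8

set_option linter.dupNamespace false -- summit = problem name (single-conjunct summit), D-0017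

open Real

set_option maxHeartbeats 400000 in
/-- **Threshold `X3` at the (c-D) depth** (one disclosed heartbeat raise to 400000: 21 monomials): in the flow currency (`k_r = κ_r/Λ^{r+1}`, `G₀ = g₀u`, `G_i = g_iu²` (`i ≥ 1`), `α_k = a_k/Λ^k`, `0 < u = |U| ≤ 1`,
`0 < Λ ≤ e₀`) the condition `3·X3 ≤ k₁G₃·x^3` holds for every depth `x` with `1024e₀² ≤ x·u²Λ²` (i.e. `x = 4^m`, `m ≥ m₀(j) = 2j+5+⌈log₄U⁻²⌉`,
`Λ = Λ_j`) as soon as ONE `u`-free smallness condition `3·u·S ≤ 1073741824·κ₁g₃·e₀^6` holds (`S` explicit below). -/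
theorem cd_threshold_X3 {{κ₁ κ₂ κ₃ κ₄ g₀ g₁ g₂ g₃ a₁ a₂ a₃ b₁ b₂ b₂' b₃ e₀ Λ u x k₁ k₂ k₃ k₄ G₀ G₁ G₂ G₃ α₁ α₂ α₃ : ℝ}}
    (hκ₁ : 0 ≤ κ₁) (hκ₂ : 0 ≤ κ₂) (hκ₃ : 0 ≤ κ₃) (hκ₄ : 0 ≤ κ₄) (hg₀ : 0 ≤ g₀) (hg₁ : 0 ≤ g₁) (hg₂ : 0 ≤ g₂) (hg₃ : 0 ≤ g₃) (ha₁ : 0 ≤ a₁) (ha₂ : 0 ≤ a₂) (ha₃ : 0 ≤ a₃) (hb₁ : 0 ≤ b₁) (hb₂ : 0 ≤ b₂) (hb₂' : 0 ≤ b₂') (hb₃ : 0 ≤ b₃)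
    (hΛ : 0 < Λ) (hΛe : Λ ≤ e₀) (hu0 : 0 < u) (hu1 : u ≤ 1) (hx : 1024 * e₀ ^ 2 ≤ x * (u ^ 2 * Λ ^ 2))
    (hk₁ : k₁ = κ₁ / Λ ^ 2) (hk₂ : k₂ = κ₂ / Λ ^ 3) (hk₃ : k₃ = κ₃ / Λ ^ 4) (hk₄ : k₄ = κ₄ / Λ ^ 5) (hG₀ : G₀ = g₀ * u) (hG₁ : G₁ = g₁ * u ^ 2) (hG₂ : G₂ = g₂ * u ^ 2) (hG₃ : G₃ = g₃ * u ^ 2) (hα₁ : α₁ = a₁ / Λ) (hα₂ : α₂ = a₂ / Λ ^ 2) (hα₃ : α₃ = a₃ / Λ ^ 3)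
    (hU : 3 * (u * (3 * a₁ * b₁ ^ 2 * g₀ * κ₃ * e₀ ^ 3 + b₁ ^ 3 * g₀ * κ₄ * e₀ ^ 3 + 3 * b₂' * g₀ * g₁ * κ₃ * e₀ ^ 4 + 3 * a₁ * g₀ * g₂ * κ₂ * e₀ ^ 4 + 3 * b₁ * g₀ * g₂ * κ₃ * e₀ ^ 4 + 3 * a₁ * b₂ * g₀ * κ₂ * e₀ ^ 4 + 3 * a₂ * b₁ * g₀ * κ₂ * e₀ ^ 3 + 3 * b₁ * b₂ * g₀ * κ₃ * e₀ ^ 4 + 3 * a₁ * g₁ ^ 2 * κ₂ * e₀ ^ 4 + 3 * b₁ * g₁ ^ 2 * κ₃ * e₀ ^ 4 + a₃ * g₀ * κ₁ * e₀ ^ 3 + b₃ * g₀ * κ₂ * e₀ ^ 5 + 6 * a₁ * b₁ * g₀ * g₁ * κ₃ * e₀ ^ 3 + 3 * b₁ ^ 2 * g₀ * g₁ * κ₄ * e₀ ^ 3 + 3 * g₀ * g₁ * g₂ * κ₃ * e₀ ^ 4 + 3 * a₂ * g₀ * g₁ * κ₂ * e₀ ^ 3 + 3 * b₂ * g₀ *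 g₁ * κ₃ * e₀ ^ 4 + g₁ ^ 3 * κ₃ * e₀ ^ 4 + 3 * a₁ * g₀ * g₁ ^ 2 * κ₃ * e₀ ^ 3 + 3 * b₁ * g₀ * g₁ ^ 2 * κ₄ * e₀ ^ 3 + g₀ * g₁ ^ 3 * κ₄ * e₀ ^ 3)) ≤
      1073741824 * κ₁ * g₃ * e₀ ^ 6) :
    3 * ((3 * G₀ * k₃ * α₁ * b₁ ^ 2 + G₀ * k₄ * b₁ ^ 3 + 3 * G₀ * G₁ * k₃ * b₂' + 3 * G₀ * G₂ * k₂ * α₁ + 3 * G₀ * G₂ * k₃ * b₁ + 3 * G₀ * k₂ * α₁ * b₂ + 3 * G₀ * k₂ * α₂ * b₁ + 3 * G₀ * k₃ * b₁ * b₂ + 3 * G₁ ^ 2 * k₂ * α₁ + 3 * G₁ ^ 2 * k₃ * b₁ + G₀ * k₁ * α₃ + G₀ * k₂ * b₃) + (6 * G₀ * G₁ * k₃ * α₁ * b₁ + 3 * G₀ * G₁ * k₄ * b₁ ^ 2 + 3 * G₀ * G₁ * G₂ * k₃ + 3 * G₀ * G₁ * k₂ * α₂ + 3 * G₀ * G₁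 * k₃ * b₂ + G₁ ^ 3 * k₃) + (3 * G₀ * G₁ ^ 2 * k₃ * α₁ + 3 * G₀ * G₁ ^ 2 * k₄ * b₁) + (G₀ * G₁ ^ 3 * k₄)) ≤ k₁ * G₃ * x ^ 3 := by
  subst hk₁ hk₂ hk₃ hk₄ hG₀ hG₁ hG₂ hG₃ hα₁ hα₂ hα₃
  have he : 0 < e₀ := lt_of_lt_of_le hΛ hΛe
  have t0 : (3 * a₁ * b₁ ^ 2 * g₀ * κ₃) * u ^ 5 * Λ ^ 3 ≤ (3 * a₁ * b₁ ^ 2 * g₀ * κ₃ * e₀ ^ 3) * u :=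
    le_of_le_of_eq (mul_le_mul (mul_le_mul_of_nonneg_left (pow_le_of_le_one hu0.le hu1 (by norm_num)) (by positivity))
      (pow_le_pow_left₀ hΛ.le hΛe 3) (by positivity) (by positivity)) (by ring)
  have t1 : (b₁ ^ 3 * g₀ * κ₄) * u ^ 5 * Λ ^ 3 ≤ (b₁ ^ 3 * g₀ * κ₄ * e₀ ^ 3) * u :=
    le_of_le_of_eq (mul_le_mul (mul_le_mul_of_nonneg_left (pow_le_of_le_one hu0.le hu1 (by norm_num)) (by positivity))
      (pow_le_pow_left₀ hΛ.le hΛe 3) (by positivity) (by positivity)) (by ring)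
  have t2 : (3 * b₂' * g₀ * g₁ * κ₃) * u ^ 7 * Λ ^ 4 ≤ (3 * b₂' * g₀ * g₁ * κ₃ * e₀ ^ 4) * u :=
    le_of_le_of_eq (mul_le_mul (mul_le_mul_of_nonneg_left (pow_le_of_le_one hu0.le hu1 (by norm_num)) (by positivity))
      (pow_le_pow_left₀ hΛ.le hΛe 4) (by positivity) (by positivity)) (by ring)
  have t3 : (3 * a₁ * g₀ * g₂ * κ₂) * u ^ 7 * Λ ^ 4 ≤ (3 * a₁ * g₀ * g₂ * κ₂ * e₀ ^ 4) * u :=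
    le_of_le_of_eq (mul_le_mul (mul_le_mul_of_nonneg_left (pow_le_of_le_one hu0.le hu1 (by norm_num)) (by positivity))
      (pow_le_pow_left₀ hΛ.le hΛe 4) (by positivity) (by positivity)) (by ring)
  have t4 : (3 * b₁ * g₀ * g₂ * κ₃) * u ^ 7 * Λ ^ 4 ≤ (3 * b₁ * g₀ * g₂ * κ₃ * e₀ ^ 4) * u :=
    le_of_le_of_eq (mul_le_mul (mul_le_mul_of_nonneg_left (pow_le_of_le_one hu0.le hu1 (by norm_num)) (by positivity))
      (pow_le_pow_left₀ hΛ.le hΛe 4) (by positivity) (by positivity)) (by ring)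
  have t5 : (3 * a₁ * b₂ * g₀ * κ₂) * u ^ 5 * Λ ^ 4 ≤ (3 * a₁ * b₂ * g₀ * κ₂ * e₀ ^ 4) * u :=
    le_of_le_of_eq (mul_le_mul (mul_le_mul_of_nonneg_left (pow_le_of_le_one hu0.le hu1 (by norm_num)) (by positivity))
      (pow_le_pow_left₀ hΛ.le hΛe 4) (by positivity) (by positivity)) (by ring)
  have t6 : (3 * a₂ * b₁ * g₀ * κ₂) * u ^ 5 * Λ ^ 3 ≤ (3 * a₂ * b₁ * g₀ * κ₂ * e₀ ^ 3) * u :=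
    le_of_le_of_eq (mul_le_mul (mul_le_mul_of_nonneg_left (pow_le_of_le_one hu0.le hu1 (by norm_num)) (by positivity))
      (pow_le_pow_left₀ hΛ.le hΛe 3) (by positivity) (by positivity)) (by ring)
  have t7 : (3 * b₁ * b₂ * g₀ * κ₃) * u ^ 5 * Λ ^ 4 ≤ (3 * b₁ * b₂ * g₀ * κ₃ * e₀ ^ 4) * u :=
    le_of_le_of_eq (mul_le_mul (mul_le_mul_of_nonneg_left (pow_le_of_le_one hu0.le hu1 (by norm_num)) (by positivity))
      (pow_le_pow_left₀ hΛ.le hΛe 4) (by positivity) (by positivity)) (by ring)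
  have t8 : (3 * a₁ * g₁ ^ 2 * κ₂) * u ^ 8 * Λ ^ 4 ≤ (3 * a₁ * g₁ ^ 2 * κ₂ * e₀ ^ 4) * u :=
    le_of_le_of_eq (mul_le_mul (mul_le_mul_of_nonneg_left (pow_le_of_le_one hu0.le hu1 (by norm_num)) (by positivity))
      (pow_le_pow_left₀ hΛ.le hΛe 4) (by positivity) (by positivity)) (by ring)
  have t9 : (3 * b₁ * g₁ ^ 2 * κ₃) * u ^ 8 * Λ ^ 4 ≤ (3 * b₁ * g₁ ^ 2 * κ₃ * e₀ ^ 4) * u :=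
    le_of_le_of_eq (mul_le_mul (mul_le_mul_of_nonneg_left (pow_le_of_le_one hu0.le hu1 (by norm_num)) (by positivity))
      (pow_le_pow_left₀ hΛ.le hΛe 4) (by positivity) (by positivity)) (by ring)
  have t10 : (a₃ * g₀ * κ₁) * u ^ 5 * Λ ^ 3 ≤ (a₃ * g₀ * κ₁ * e₀ ^ 3) * u :=
    le_of_le_of_eq (mul_le_mul (mul_le_mul_of_nonneg_left (pow_le_of_le_one hu0.le hu1 (by norm_num)) (by positivity))
      (pow_le_pow_left₀ hΛ.le hΛe 3) (by positivity) (by positivity)) (by ring)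
  have t11 : (b₃ * g₀ * κ₂) * u ^ 5 * Λ ^ 5 ≤ (b₃ * g₀ * κ₂ * e₀ ^ 5) * u :=
    le_of_le_of_eq (mul_le_mul (mul_le_mul_of_nonneg_left (pow_le_of_le_one hu0.le hu1 (by norm_num)) (by positivity))
      (pow_le_pow_left₀ hΛ.le hΛe 5) (by positivity) (by positivity)) (by ring)
  have t12 : (6 * a₁ * b₁ * g₀ * g₁ * κ₃) * u ^ 7 * Λ ^ 3 ≤ (6 * a₁ * b₁ * g₀ * g₁ * κ₃ * e₀ ^ 3) * u :=
    le_of_le_of_eq (mul_le_mul (mul_le_mul_of_nonneg_left (pow_le_of_le_one hu0.le hu1 (by norm_num)) (by positivity))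
      (pow_le_pow_left₀ hΛ.le hΛe 3) (by positivity) (by positivity)) (by ring)
  have t13 : (3 * b₁ ^ 2 * g₀ * g₁ * κ₄) * u ^ 7 * Λ ^ 3 ≤ (3 * b₁ ^ 2 * g₀ * g₁ * κ₄ * e₀ ^ 3) * u :=
    le_of_le_of_eq (mul_le_mul (mul_le_mul_of_nonneg_left (pow_le_of_le_one hu0.le hu1 (by norm_num)) (by positivity))
      (pow_le_pow_left₀ hΛ.le hΛe 3) (by positivity) (by positivity)) (by ring)
  have t14 : (3 * g₀ * g₁ * g₂ * κ₃) * u ^ 9 * Λ ^ 4 ≤ (3 * g₀ * g₁ * g₂ * κ₃ * e₀ ^ 4) * u :=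
    le_of_le_of_eq (mul_le_mul (mul_le_mul_of_nonneg_left (pow_le_of_le_one hu0.le hu1 (by norm_num)) (by positivity))
      (pow_le_pow_left₀ hΛ.le hΛe 4) (by positivity) (by positivity)) (by ring)
  have t15 : (3 * a₂ * g₀ * g₁ * κ₂) * u ^ 7 * Λ ^ 3 ≤ (3 * a₂ * g₀ * g₁ * κ₂ * e₀ ^ 3) * u :=
    le_of_le_of_eq (mul_le_mul (mul_le_mul_of_nonneg_left (pow_le_of_le_one hu0.le hu1 (by norm_num)) (by positivity))
      (pow_le_pow_left₀ hΛ.le hΛe 3) (by positivity) (by positivity)) (by ring)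
  have t16 : (3 * b₂ * g₀ * g₁ * κ₃) * u ^ 7 * Λ ^ 4 ≤ (3 * b₂ * g₀ * g₁ * κ₃ * e₀ ^ 4) * u :=
    le_of_le_of_eq (mul_le_mul (mul_le_mul_of_nonneg_left (pow_le_of_le_one hu0.le hu1 (by norm_num)) (by positivity))
      (pow_le_pow_left₀ hΛ.le hΛe 4) (by positivity) (by positivity)) (by ring)
  have t17 : (g₁ ^ 3 * κ₃) * u ^ 10 * Λ ^ 4 ≤ (g₁ ^ 3 * κ₃ * e₀ ^ 4) * u :=
    le_of_le_of_eq (mul_le_mul (mul_le_mul_of_nonneg_left (pow_le_of_le_one hu0.le hu1 (by norm_num)) (by positivity))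
      (pow_le_pow_left₀ hΛ.le hΛe 4) (by positivity) (by positivity)) (by ring)
  have t18 : (3 * a₁ * g₀ * g₁ ^ 2 * κ₃) * u ^ 9 * Λ ^ 3 ≤ (3 * a₁ * g₀ * g₁ ^ 2 * κ₃ * e₀ ^ 3) * u :=
    le_of_le_of_eq (mul_le_mul (mul_le_mul_of_nonneg_left (pow_le_of_le_one hu0.le hu1 (by norm_num)) (by positivity))
      (pow_le_pow_left₀ hΛ.le hΛe 3) (by positivity) (by positivity)) (by ring)
  have t19 : (3 * b₁ * g₀ * g₁ ^ 2 * κ₄) * u ^ 9 * Λ ^ 3 ≤ (3 * b₁ * g₀ * g₁ ^ 2 * κ₄ * e₀ ^ 3) * u :=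
    le_of_le_of_eq (mul_le_mul (mul_le_mul_of_nonneg_left (pow_le_of_le_one hu0.le hu1 (by norm_num)) (by positivity))
      (pow_le_pow_left₀ hΛ.le hΛe 3) (by positivity) (by positivity)) (by ring)
  have t20 : (g₀ * g₁ ^ 3 * κ₄) * u ^ 11 * Λ ^ 3 ≤ (g₀ * g₁ ^ 3 * κ₄ * e₀ ^ 3) * u :=
    le_of_le_of_eq (mul_le_mul (mul_le_mul_of_nonneg_left (pow_le_of_le_one hu0.le hu1 (by norm_num)) (by positivity))
      (pow_le_pow_left₀ hΛ.le hΛe 3) (by positivity) (by positivity)) (by ring)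
  have hS : ((3 * (g₀ * u) * (κ₃ / Λ ^ 4) * (a₁ / Λ) * b₁ ^ 2 + (g₀ * u) * (κ₄ / Λ ^ 5) * b₁ ^ 3 + 3 * (g₀ * u) * (g₁ * u ^ 2) * (κ₃ / Λ ^ 4) * b₂' + 3 * (g₀ * u) * (g₂ * u ^ 2) * (κ₂ / Λ ^ 3) * (a₁ / Λ) + 3 * (g₀ * u) * (g₂ * u ^ 2) * (κ₃ / Λ ^ 4) * b₁ + 3 * (g₀ * u) * (κ₂ / Λ ^ 3) * (a₁ / Λ) * b₂ + 3 * (g₀ * u) * (κ₂ / Λ ^ 3) * (a₂ / Λ ^ 2) * b₁ + 3 * (g₀ * u) * (κ₃ / Λ ^ 4) * b₁ * b₂ + 3 * (g₁ * u ^ 2) ^ 2 * (κ₂ / Λ ^ 3) * (a₁ / Λ) + 3 * (g₁ * u ^ 2) ^ 2 * (κ₃ / Λ ^ 4) * b₁ + (g₀ * u) * (κ₁ / Λ ^ 2) * (a₃ / Λ ^ 3) + (g₀ * u) * (κ₂ / Λ ^ 3) * b₃) + (6 * (g₀ * u) * (g₁ * u ^ 2) * (κ₃ / Λ ^ 4)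 * (a₁ / Λ) * b₁ + 3 * (g₀ * u) * (g₁ * u ^ 2) * (κ₄ / Λ ^ 5) * b₁ ^ 2 + 3 * (g₀ * u) * (g₁ * u ^ 2) * (g₂ * u ^ 2) * (κ₃ / Λ ^ 4) + 3 * (g₀ * u) * (g₁ * u ^ 2) * (κ₂ / Λ ^ 3) * (a₂ / Λ ^ 2) + 3 * (g₀ * u) * (g₁ * u ^ 2) * (κ₃ / Λ ^ 4) * b₂ + (g₁ * u ^ 2) ^ 3 * (κ₃ / Λ ^ 4)) + (3 * (g₀ * u) * (g₁ * u ^ 2) ^ 2 * (κ₃ / Λ ^ 4) * (a₁ / Λ) + 3 * (g₀ * u) * (g₁ * u ^ 2) ^ 2 * (κ₄ / Λ ^ 5) * b₁) + ((g₀ * u) * (g₁ * u ^ 2) ^ 3 * (κ₄ / Λ ^ 5))) * (u ^ 4 * Λ ^ 8) ≤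
      (3 * a₁ * b₁ ^ 2 * g₀ * κ₃ * e₀ ^ 3 + b₁ ^ 3 * g₀ * κ₄ * e₀ ^ 3 + 3 * b₂' * g₀ * g₁ * κ₃ * e₀ ^ 4 + 3 * a₁ * g₀ * g₂ * κ₂ * e₀ ^ 4 + 3 * b₁ * g₀ * g₂ * κ₃ * e₀ ^ 4 + 3 * a₁ * b₂ * g₀ * κ₂ * e₀ ^ 4 + 3 * a₂ * b₁ * g₀ * κ₂ * e₀ ^ 3 + 3 * b₁ * b₂ * g₀ * κ₃ * e₀ ^ 4 + 3 * a₁ * g₁ ^ 2 * κ₂ * e₀ ^ 4 + 3 * b₁ * g₁ ^ 2 * κ₃ * e₀ ^ 4 + a₃ * g₀ * κ₁ * e₀ ^ 3 + b₃ * g₀ * κ₂ * e₀ ^ 5 + 6 * a₁ * b₁ * g₀ * g₁ * κ₃ * e₀ ^ 3 + 3 * b₁ ^ 2 * g₀ * g₁ * κ₄ * e₀ ^ 3 + 3 * g₀ * g₁ * g₂ * κ₃ * e₀ ^ 4 + 3 * a₂ * g₀ * g₁ * κ₂ * e₀ ^ 3 + 3 * b₂ * g₀ * g₁ * κ₃ *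 e₀ ^ 4 + g₁ ^ 3 * κ₃ * e₀ ^ 4 + 3 * a₁ * g₀ * g₁ ^ 2 * κ₃ * e₀ ^ 3 + 3 * b₁ * g₀ * g₁ ^ 2 * κ₄ * e₀ ^ 3 + g₀ * g₁ ^ 3 * κ₄ * e₀ ^ 3) * u := by
    have e : ((3 * (g₀ * u) * (κ₃ / Λ ^ 4) * (a₁ / Λ) * b₁ ^ 2 + (g₀ * u) * (κ₄ / Λ ^ 5) * b₁ ^ 3 + 3 * (g₀ * u) * (g₁ * u ^ 2) * (κ₃ / Λ ^ 4) * b₂' + 3 * (g₀ * u) * (g₂ * u ^ 2) * (κ₂ / Λ ^ 3) * (a₁ / Λ) + 3 * (g₀ * u) * (g₂ * u ^ 2) * (κ₃ / Λ ^ 4) * b₁ + 3 * (g₀ * u) * (κ₂ / Λ ^ 3) * (a₁ / Λ) * b₂ + 3 * (g₀ * u) * (κ₂ / Λ ^ 3) * (a₂ / Λ ^ 2) * b₁ + 3 * (g₀ * u) * (κ₃ / Λ ^ 4) * b₁ * b₂ + 3 * (g₁ * u ^ 2) ^ 2 * (κ₂ / Λ ^ 3) * (a₁ / Λ) + 3 *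 (g₁ * u ^ 2) ^ 2 * (κ₃ / Λ ^ 4) * b₁ + (g₀ * u) * (κ₁ / Λ ^ 2) * (a₃ / Λ ^ 3) + (g₀ * u) * (κ₂ / Λ ^ 3) * b₃) + (6 * (g₀ * u) * (g₁ * u ^ 2) * (κ₃ / Λ ^ 4) * (a₁ / Λ) * b₁ + 3 * (g₀ * u) * (g₁ * u ^ 2) * (κ₄ / Λ ^ 5) * b₁ ^ 2 + 3 * (g₀ * u) * (g₁ * u ^ 2) * (g₂ * u ^ 2) * (κ₃ / Λ ^ 4) + 3 * (g₀ * u) * (g₁ * u ^ 2) * (κ₂ / Λ ^ 3) * (a₂ / Λ ^ 2) + 3 * (g₀ * u) * (g₁ * u ^ 2) * (κ₃ / Λ ^ 4) * b₂ + (g₁ * u ^ 2) ^ 3 * (κ₃ / Λ ^ 4)) + (3 * (g₀ * u) * (g₁ * u ^ 2) ^ 2 * (κ₃ / Λ ^ 4) * (a₁ / Λ) + 3 * (g₀ * u) * (g₁ * u ^ 2) ^ 2 * (κ₄ / Λ ^ 5) * b₁) + ((g₀ * u) * (g₁ * u ^ 2) ^ 3 * (κ₄ / Λ ^ 5))) *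 (u ^ 4 * Λ ^ 8) =
        (3 * a₁ * b₁ ^ 2 * g₀ * κ₃) * u ^ 5 * Λ ^ 3 + (b₁ ^ 3 * g₀ * κ₄) * u ^ 5 * Λ ^ 3 + (3 * b₂' * g₀ * g₁ * κ₃) * u ^ 7 * Λ ^ 4 + (3 * a₁ * g₀ * g₂ * κ₂) * u ^ 7 * Λ ^ 4 + (3 * b₁ * g₀ * g₂ * κ₃) * u ^ 7 * Λ ^ 4 + (3 * a₁ * b₂ * g₀ * κ₂) * u ^ 5 * Λ ^ 4 + (3 * a₂ * b₁ * g₀ * κ₂) * u ^ 5 * Λ ^ 3 + (3 * b₁ * b₂ * g₀ * κ₃) * u ^ 5 * Λ ^ 4 + (3 * a₁ * g₁ ^ 2 * κ₂) * u ^ 8 * Λ ^ 4 + (3 * b₁ * g₁ ^ 2 * κ₃) * u ^ 8 * Λ ^ 4 + (a₃ * g₀ * κ₁) * u ^ 5 * Λ ^ 3 + (b₃ * g₀ * κ₂) * u ^ 5 * Λ ^ 5 + (6 * a₁ * b₁ * g₀ * g₁ * κ₃) * u ^ 7 * Λ ^ 3 + (3 * b₁ ^ 2 * g₀ * g₁ *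 κ₄) * u ^ 7 * Λ ^ 3 + (3 * g₀ * g₁ * g₂ * κ₃) * u ^ 9 * Λ ^ 4 + (3 * a₂ * g₀ * g₁ * κ₂) * u ^ 7 * Λ ^ 3 + (3 * b₂ * g₀ * g₁ * κ₃) * u ^ 7 * Λ ^ 4 + (g₁ ^ 3 * κ₃) * u ^ 10 * Λ ^ 4 + (3 * a₁ * g₀ * g₁ ^ 2 * κ₃) * u ^ 9 * Λ ^ 3 + (3 * b₁ * g₀ * g₁ ^ 2 * κ₄) * u ^ 9 * Λ ^ 3 + (g₀ * g₁ ^ 3 * κ₄) * u ^ 11 * Λ ^ 3 := by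
      field_simp
      ring
    rw [e]
    linarith only [t0, t1, t2, t3, t4, t5, t6, t7, t8, t9, t10, t11, t12, t13, t14, t15, t16, t17, t18, t19, t20]
  have hT : 1073741824 * κ₁ * g₃ * e₀ ^ 6 ≤ κ₁ / Λ ^ 2 * (g₃ * u ^ 2) * x ^ 3 * (u ^ 4 * Λ ^ 8) := by
    have hxi : (1024 * e₀ ^ 2) ^ 3 ≤ (x * (u ^ 2 * Λ ^ 2)) ^ 3 := pow_le_pow_left₀ (by positivity) hx 3
    calc 1073741824 * κ₁ * g₃ * e₀ ^ 6 = κ₁ * g₃ * (1024 * e₀ ^ 2) ^ 3 := by ring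
      _ ≤ κ₁ * g₃ * (x * (u ^ 2 * Λ ^ 2)) ^ 3 := mul_le_mul_of_nonneg_left hxi (by positivity)
      _ = κ₁ / Λ ^ 2 * (g₃ * u ^ 2) * x ^ 3 * (u ^ 4 * Λ ^ 8) := by field_simp
  have hw : 0 < (u ^ 4 * Λ ^ 8) := by positivity
  refine le_of_mul_le_mul_right ?_ hw
  calc 3 * ((3 * (g₀ * u) * (κ₃ / Λ ^ 4) * (a₁ / Λ) * b₁ ^ 2 + (g₀ * u) * (κ₄ / Λ ^ 5) * b₁ ^ 3 + 3 * (g₀ * u) * (g₁ * u ^ 2) * (κ₃ / Λ ^ 4) * b₂' + 3 * (g₀ * u) * (g₂ * u ^ 2) * (κ₂ / Λ ^ 3) * (a₁ / Λ) + 3 * (g₀ * u) * (g₂ * u ^ 2) * (κ₃ / Λ ^ 4) * b₁ + 3 * (g₀ * u) * (κ₂ / Λ ^ 3) * (a₁ / Λ) * b₂ + 3 * (g₀ * u) * (κ₂ / Λ ^ 3) * (a₂ / Λ ^ 2) * b₁ + 3 * (g₀ * u) * (κ₃ / Λ ^ 4) * b₁ * b₂ + 3 * (g₁ * u ^ 2)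 ^ 2 * (κ₂ / Λ ^ 3) * (a₁ / Λ) + 3 * (g₁ * u ^ 2) ^ 2 * (κ₃ / Λ ^ 4) * b₁ + (g₀ * u) * (κ₁ / Λ ^ 2) * (a₃ / Λ ^ 3) + (g₀ * u) * (κ₂ / Λ ^ 3) * b₃) + (6 * (g₀ * u) * (g₁ * u ^ 2) * (κ₃ / Λ ^ 4) * (a₁ / Λ) * b₁ + 3 * (g₀ * u) * (g₁ * u ^ 2) * (κ₄ / Λ ^ 5) * b₁ ^ 2 + 3 * (g₀ * u) * (g₁ * u ^ 2) * (g₂ * u ^ 2) * (κ₃ / Λ ^ 4) + 3 * (g₀ * u) * (g₁ * u ^ 2) * (κ₂ / Λ ^ 3) * (a₂ / Λ ^ 2) + 3 * (g₀ * u) * (g₁ * u ^ 2) * (κ₃ / Λ ^ 4) * b₂ + (g₁ * u ^ 2) ^ 3 * (κ₃ / Λ ^ 4)) + (3 * (g₀ * u) * (g₁ * u ^ 2) ^ 2 * (κ₃ / Λ ^ 4) * (a₁ / Λ) + 3 * (g₀ * u) * (g₁ * u ^ 2) ^ 2 * (κ₄ / Λ ^ 5) * b₁) + ((g₀ * u)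 * (g₁ * u ^ 2) ^ 3 * (κ₄ / Λ ^ 5))) * (u ^ 4 * Λ ^ 8) = 3 * (((3 * (g₀ * u) * (κ₃ / Λ ^ 4) * (a₁ / Λ) * b₁ ^ 2 + (g₀ * u) * (κ₄ / Λ ^ 5) * b₁ ^ 3 + 3 * (g₀ * u) * (g₁ * u ^ 2) * (κ₃ / Λ ^ 4) * b₂' + 3 * (g₀ * u) * (g₂ * u ^ 2) * (κ₂ / Λ ^ 3) * (a₁ / Λ) + 3 * (g₀ * u) * (g₂ * u ^ 2) * (κ₃ / Λ ^ 4) * b₁ + 3 * (g₀ * u) * (κ₂ / Λ ^ 3) * (a₁ / Λ) * b₂ + 3 * (g₀ * u) * (κ₂ / Λ ^ 3) * (a₂ / Λ ^ 2) * b₁ + 3 * (g₀ * u) * (κ₃ / Λ ^ 4) * b₁ * b₂ + 3 * (g₁ * u ^ 2) ^ 2 * (κ₂ / Λ ^ 3) * (a₁ / Λ) + 3 * (g₁ * u ^ 2) ^ 2 * (κ₃ / Λ ^ 4) * b₁ + (g₀ * u) * (κ₁ / Λ ^ 2) * (a₃ / Λ ^ 3) + (g₀ * u) * (κ₂ / Λ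 ^ 3) * b₃) + (6 * (g₀ * u) * (g₁ * u ^ 2) * (κ₃ / Λ ^ 4) * (a₁ / Λ) * b₁ + 3 * (g₀ * u) * (g₁ * u ^ 2) * (κ₄ / Λ ^ 5) * b₁ ^ 2 + 3 * (g₀ * u) * (g₁ * u ^ 2) * (g₂ * u ^ 2) * (κ₃ / Λ ^ 4) + 3 * (g₀ * u) * (g₁ * u ^ 2) * (κ₂ / Λ ^ 3) * (a₂ / Λ ^ 2) + 3 * (g₀ * u) * (g₁ * u ^ 2) * (κ₃ / Λ ^ 4) * b₂ + (g₁ * u ^ 2) ^ 3 * (κ₃ / Λ ^ 4)) + (3 * (g₀ * u) * (g₁ * u ^ 2) ^ 2 * (κ₃ / Λ ^ 4) * (a₁ / Λ) + 3 * (g₀ * u) * (g₁ * u ^ 2) ^ 2 * (κ₄ / Λ ^ 5) * b₁) + ((g₀ * u) * (g₁ * u ^ 2) ^ 3 * (κ₄ / Λ ^ 5))) * (u ^ 4 * Λ ^ 8)) := by ring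
    _ ≤ 3 * ((3 * a₁ * b₁ ^ 2 * g₀ * κ₃ * e₀ ^ 3 + b₁ ^ 3 * g₀ * κ₄ * e₀ ^ 3 + 3 * b₂' * g₀ * g₁ * κ₃ * e₀ ^ 4 + 3 * a₁ * g₀ * g₂ * κ₂ * e₀ ^ 4 + 3 * b₁ * g₀ * g₂ * κ₃ * e₀ ^ 4 + 3 * a₁ * b₂ * g₀ * κ₂ * e₀ ^ 4 + 3 * a₂ * b₁ * g₀ * κ₂ * e₀ ^ 3 + 3 * b₁ * b₂ * g₀ * κ₃ * e₀ ^ 4 + 3 * a₁ * g₁ ^ 2 * κ₂ * e₀ ^ 4 + 3 * b₁ * g₁ ^ 2 * κ₃ * e₀ ^ 4 + a₃ * g₀ * κ₁ * e₀ ^ 3 + b₃ * g₀ * κ₂ * e₀ ^ 5 + 6 * a₁ * b₁ * g₀ * g₁ * κ₃ * e₀ ^ 3 + 3 * b₁ ^ 2 * g₀ * g₁ * κ₄ * e₀ ^ 3 + 3 * g₀ * g₁ * g₂ * κ₃ * e₀ ^ 4 + 3 * a₂ * g₀ * g₁ * κ₂ * e₀ ^ 3 + 3 * b₂ * g₀ *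 g₁ * κ₃ * e₀ ^ 4 + g₁ ^ 3 * κ₃ * e₀ ^ 4 + 3 * a₁ * g₀ * g₁ ^ 2 * κ₃ * e₀ ^ 3 + 3 * b₁ * g₀ * g₁ ^ 2 * κ₄ * e₀ ^ 3 + g₀ * g₁ ^ 3 * κ₄ * e₀ ^ 3) * u) := mul_le_mul_of_nonneg_left hS (by norm_num)
    _ = 3 * (u * (3 * a₁ * b₁ ^ 2 * g₀ * κ₃ * e₀ ^ 3 + b₁ ^ 3 * g₀ * κ₄ * e₀ ^ 3 + 3 * b₂' * g₀ * g₁ * κ₃ * e₀ ^ 4 + 3 * a₁ * g₀ * g₂ * κ₂ * e₀ ^ 4 + 3 * b₁ * g₀ * g₂ * κ₃ * e₀ ^ 4 + 3 * a₁ * b₂ * g₀ * κ₂ * e₀ ^ 4 + 3 * a₂ * b₁ * g₀ * κ₂ * e₀ ^ 3 + 3 * b₁ * b₂ * g₀ * κ₃ * e₀ ^ 4 + 3 * a₁ * g₁ ^ 2 * κ₂ * e₀ ^ 4 + 3 * b₁ * g₁ ^ 2 * κ₃ * e₀ ^ 4 + a₃ * g₀ * κ₁ * e₀ ^ 3 +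 b₃ * g₀ * κ₂ * e₀ ^ 5 + 6 * a₁ * b₁ * g₀ * g₁ * κ₃ * e₀ ^ 3 + 3 * b₁ ^ 2 * g₀ * g₁ * κ₄ * e₀ ^ 3 + 3 * g₀ * g₁ * g₂ * κ₃ * e₀ ^ 4 + 3 * a₂ * g₀ * g₁ * κ₂ * e₀ ^ 3 + 3 * b₂ * g₀ * g₁ * κ₃ * e₀ ^ 4 + g₁ ^ 3 * κ₃ * e₀ ^ 4 + 3 * a₁ * g₀ * g₁ ^ 2 * κ₃ * e₀ ^ 3 + 3 * b₁ * g₀ * g₁ ^ 2 * κ₄ * e₀ ^ 3 + g₀ * g₁ ^ 3 * κ₄ * e₀ ^ 3)) := by ring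
    _ ≤ 1073741824 * κ₁ * g₃ * e₀ ^ 6 := hU
    _ ≤ κ₁ / Λ ^ 2 * (g₃ * u ^ 2) * x ^ 3 * (u ^ 4 * Λ ^ 8) := hT

end Summit.HubbardSuperconductivity.HubbardSuperconductivity.Theorems.EngineV8

end
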